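import Mathlib.Tactic
import Literature.Computability.QuantumComplexity.SimUniformity
import Literature.Computability.Complexity.Promise
import Literature.Computability.Cryptography.ClassBQP
import Summits.QuantumAdvantage.QuantumAdvantage.Statement
import Summits.QuantumAdvantage.QuantumAdvantage.Theorems.SoloInformedPseudoDeterministicLift
import HarnessLib

/-!
# SoloInformedLiftDichotomy — `Q-EXT ∨ PSep`, and the three worlds

Solo seat `solo-QuantumAdvantage-informed` (ideation tier, summit-directed). With
`Q-EXT := PromiseBQP ⊆ promiseLift BQP` (every `PromiseBQP` problem is solved by a `BQP` language) and
`PSep := ¬(PromiseBQP ⊆ promiseLift BPP)` (some `PromiseBQP` problem is solved by no `BPP` language;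
`PromiseBPP = promiseLift BPP` in the tree), the discharged fact `BPP ⊆ BQP` (`BPP_subset_BQP_holds`) gives
`promiseLift BPP ⊆ promiseLift BQP`, whence:

* `promiseSep_of_not_promiseIsLift : ¬Q-EXT → PSep` and the unconditional DICHOTOMY
  `promiseIsLift_or_promiseSep : Q-EXT ∨ PSep` (sharpening `promiseSep_or_lift`, which had `PromiseP`);
* `promiseIsLift_and_not_quantumAdvantage_of_not_promiseSep : ¬PSep → Q-EXT ∧ ¬QuantumAdvantage` — the world
  "quantum = classical on promise problems" settles both the lift hypothesis (true) and the summit (false);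
* `quantumAdvantage_or_not_promiseIsLift_of_promiseSep`, `not_promiseSep_or_not_promiseIsLift_of_not_quantumAdvantage`
  — hence the summit is decided in two of the three worlds: `¬PSep ⇒ ¬summit`, `PSep ∧ Q-EXT ⇒ summit`; only
  `PSep ∧ ¬Q-EXT` (realised relative to the oracle of `Literature.Barriers.QuantumAdvantage.PromiseLiftRelativization`)
  leaves it open, and there the obstruction is exactly a `PromiseBQP` problem none of whose completions is a
  `BQP` language.

[cite: Goldreich2006, Def. 1.2] [cite: BernsteinVazirani1997, Thm. 8.3 (BPP ⊆ BQP)]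
-/

noncomputable section

namespace Summit.QuantumAdvantage.QuantumAdvantage.Theorems

open _root_.Computability Literature.Computability.Complexity Literature.Computability.Cryptography
  Literature.Computability.QuantumComplexity

/-- `promiseLift BPP ⊆ promiseLift BQP`, from the discharged fact `BPP ⊆ BQP`.
[cite: BernsteinVazirani1997, Thm. 8.3 (BPP ⊆ BQP)] -/
theorem promiseBPP_subset_promiseLift_BQP : PromiseBPP ⊆ promiseLift BQP :=
  promiseLift_mono fun _ hL => BPP_subset_BQP_holds hL

/-- **`¬Q-EXT → PSep`**: a `PromiseBQP` problem with no `BQP` solution has, a fortiori, no `BPP` solution.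
[cite: Goldreich2006, Def. 1.2] -/
theorem promiseSep_of_not_promiseIsLift (hnExt : ¬ PromiseBQP ⊆ promiseLift BQP) :
    ¬ PromiseBQP ⊆ PromiseBPP := fun h =>
  hnExt (h.trans promiseBPP_subset_promiseLift_BQP)

/-- **The dichotomy `Q-EXT ∨ PSep`** (unconditional): either every `PromiseBQP` problem is solved by a `BQP`
language, or some `PromiseBQP` problem is solved by no `BPP` language. [cite: Goldreich2006, Def. 1.2] -/
theorem promiseIsLift_or_promiseSep :
    PromiseBQP ⊆ promiseLift BQP ∨ ¬ PromiseBQP ⊆ PromiseBPP := by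
  by_cases h : PromiseBQP ⊆ promiseLift BQP
  · exact Or.inl h
  · exact Or.inr (promiseSep_of_not_promiseIsLift h)

/-- **World 1: `¬PSep` settles everything.** If every `PromiseBQP` problem is solved by a `BPP` language then
the lift hypothesis holds and the summit fails. [cite: Goldreich2006, Def. 1.2] -/
theorem promiseIsLift_and_not_quantumAdvantage_of_not_promiseSep (h : PromiseBQP ⊆ PromiseBPP) :
    PromiseBQP ⊆ promiseLift BQP ∧ ¬ QuantumAdvantage := by
  refine ⟨h.trans promiseBPP_subset_promiseLift_BQP, fun hQA => ?_⟩
  obtain ⟨L, hL, hLB⟩ := hQA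
  have h1 : PromiseProblem.ofLanguage L ∈ PromiseBQP := ofLanguage_mem_PromiseBQP_iff.2 hL
  exact hLB (ofLanguage_mem_promiseLift_iff.1 (h h1))

/-- **Worlds 2 and 3: under `PSep` the summit holds unless the lift fails.** If some `PromiseBQP` problem
has no `BPP` solution, then either `BQP ⊄ BPP` or some `PromiseBQP` problem has no `BQP`-language completion
at all. [cite: Goldreich2006, Def. 1.2] -/
theorem quantumAdvantage_or_not_promiseIsLift_of_promiseSep (hSep : ¬ PromiseBQP ⊆ PromiseBPP) :
    QuantumAdvantage ∨ ¬ PromiseBQP ⊆ promiseLift BQP := by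
  by_cases hExt : PromiseBQP ⊆ promiseLift BQP
  · exact Or.inl (quantumAdvantage_of_promiseIsLift hExt hSep)
  · exact Or.inr hExt

/-- **The summit across the three worlds** (`¬PSep` | `PSep ∧ Q-EXT` | `PSep ∧ ¬Q-EXT`): `QuantumAdvantage`
fails in the first, holds in the second, and in the third — realised relative to the oracle of
`Literature.Barriers.QuantumAdvantage.PromiseLiftRelativization` — is left open by these facts; formally,
`¬QuantumAdvantage → (¬PSep ∨ ¬Q-EXT)`. [cite: Goldreich2006, Def. 1.2] -/
theorem not_promiseSep_or_not_promiseIsLift_of_not_quantumAdvantage (h : ¬ QuantumAdvantage) :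
    PromiseBQP ⊆ PromiseBPP ∨ ¬ PromiseBQP ⊆ promiseLift BQP := by
  by_cases hSep : PromiseBQP ⊆ PromiseBPP
  · exact Or.inl hSep
  · rcases quantumAdvantage_or_not_promiseIsLift_of_promiseSep hSep with hQA | hn
    · exact absurd hQA h
    · exact Or.inr hn

end Summit.QuantumAdvantage.QuantumAdvantage.Theorems

end
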